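import Mathlib
import HarnessLib
import HarnessLib.Audit
import Summits.SmoothPoincare4.Statement
import Literature.Topology.FourManifolds.Trisections
import Literature.Topology.FourManifolds.ClosedBall
import Literature.Topology.FourManifolds.TrisectionEulerProofs
import Literature.Topology.FourManifolds.HomotopyS4CompactProofs
import Literature.Topology.FourManifolds.HomotopyS4OrientableProofs
import Literature.Topology.FourManifolds.Morse
import Literature.Topology.FourManifolds.RLinkSphere
import Literature.Topology.FourManifolds.SliceGenus
import HarnessLib.Audit.Status.Attr

/-!
Route: RootDecompG

# Route RootDecompG — Root decomposition G (TwoHandleLadder, lens 1, gen 2, variant a2) —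
2-handle-number ladder: 2R-link spheres, item 0435, and the ceiling «two 2-handles suffice»
(declared residual) over the MSZ floor

ROOT DECOMPOSITION NODE G of cell decomp-sp4 (D-0178, LADDER-SmoothPoincare4 rung 0; lens 1 =
grading / quantitative ladder; node TwoHandleLadder, generation 2, DEDUP variant (a2), adopted by
the route-writer as OR-sibling RootDecompG — a RE-GRADING of RootDecompE (minimal trisection genus μ
↦ 2-handle number δ = g − max kᵢ), commensurable in kernel both ways and neither AND dominating the
other per the critic, so both siblings stand). TARGET = the ROOT `_root_.SmoothPoincare4` verbatim ⟸
LargeKStandard (floor support = stmt-SmoothPoincare4-25314 verbatim) ∧ TrisectionHandles (dictionary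
support = stmt-SmoothPoincare4-19737 verbatim) ∧ TwoRLinkStandard (new) ∧ GtriMorse1121 (=
stmt-SmoothPoincare4-0435 verbatim) ∧ DefectAtMostTwo (new, declared residual). It suffices to show
X = TwoRLinkStandard ∧ GtriMorse1121 ∧ DefectAtMostTwo over the floor LargeKStandard
(Meier–Schirmer–Zupan)
and the printed dictionary TrisectionHandles (Gay–Kirby / MSZ; DEDUP VARIANT a2 of the lens-1 gen-2
node: grade-2 type {g−2,1,1} filed AS the
verbatim GroupTrisection item 0435), and X is EXACTLY the summit (kernel
`smoothPoincare4_iff_twoHandleLadder` in the node file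
TwoHandleLadder.lean, decomp-sp4 cell lens-1 «grading / quantitative ladder», generation 2; no idea
card realised).
Grade a smooth homotopy 4-sphere Σ by its 2-HANDLE NUMBER h₂(Σ) = the trisection defect δ(Σ) := min
over GK-trisections
(g;k₀,k₁,k₂) of g − max kᵢ (equal by arXiv:1507.06561 Prop 4.2 / Lemma 4.6; χ = 2 forces g = Σkᵢ,
proved tree theorem):
δ ≤ 1 ⟺ Σ ≅ S⁴ is Property R / MSZ Thm 1.2 (floor; in-kernel COSTUME record
`defectAtMost_one_iff_spc4`); grade 2 splits by
the TYPE of the two non-maximal kᵢ into {2,0} = «no 1-handles, two 2-handles» (2-component R-link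
spheres; arXiv:1904.08527
Thm 1.1 is the case with a generalized-square-knot component) and {1,1} = Morse profile 1-1-2-1-1
(Gompf's twisted doubles
𝒟_m,n(K); = item stmt-SmoothPoincare4-0435 in trisection dress); the residual is the ceiling «every
Σ has h₂ ≤ 2». SmoothPoincare4 is NOT proved by anything here: the three cruxes are open and
S-implied (`twoRLinkStandard_of_spc4`, `morse11211Standard_of_spc4` / item 0435,
`defectAtMostTwo_of_spc4` in the node file), the two supports are theorems in print (provable-now
once typed against the Literature modules), the conjunction gives S by `closes`; for tribunal
scoring the ATTACKED conjunct is TwoRLinkStandard (new), GtriMorse1121 is IMPORTED (shared with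
route GroupTrisection, count once), and the ceiling DefectAtMostTwo is DECLARED RESIDUAL.
Lean: `(∀ (M : Type) [TopologicalSpace M] [T2Space M] [SecondCountableTopology M] [ChartedSpace
(EuclideanSpace ℝ (Fin 4)) M] [IsManifold (𝓡 4) ((⊤ : ℕ∞) : WithTop ℕ∞) M], (M ≃ₕ (Metric.sphere (0
: EuclideanSpace ℝ (Fin 5)) 1)) → ∀ (g : ℕ) (k : Fin 3 → ℕ) (T : Fin 3 → Set M),
Literature.Topology.FourManifolds.IsGKTrisection M g k T → (∀ i, k i + 2 ≤ g) → (∃ i, g = k i + 2) →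
(∃ j, k j = 0) → Nonempty (Diffeomorph (𝓡 4) (𝓡 4) M (Metric.sphere (0 : EuclideanSpace ℝ (Fin 5))
1) ((⊤ : ℕ∞) : WithTop ℕ∞))) ∧ (∀ (M : Type) [TopologicalSpace M] [T2Space M]
[SecondCountableTopology M] [ChartedSpace (EuclideanSpace ℝ (Fin 4)) M] [IsManifold (𝓡 4) ((⊤ : ℕ∞)
: WithTop ℕ∞) M] [CompactSpace M], M ≃ₕ Metric.sphere (0 : EuclideanSpace ℝ (Fin 5)) 1 → ∀ f : M →
ℝ, Literature.Topology.FourManifolds.IsMorse (𝓡 4) f →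
(Literature.Topology.FourManifolds.criticalSetOfIndex (𝓡 4) f 0).ncard = 1 →
(Literature.Topology.FourManifolds.criticalSetOfIndex (𝓡 4) f 1).ncard ≤ 1 →
(Literature.Topology.FourManifolds.criticalSetOfIndex (𝓡 4) f 3).ncard ≤ 1 →
(Literature.Topology.FourManifolds.criticalSetOfIndex (𝓡 4) f 4).ncard = 1 → Nonempty (Diffeomorph
(𝓡 4) (𝓡 4) M (Metric.sphere (0 : EuclideanSpace ℝ (Fin 5)) 1) ((⊤ : ℕ∞) : WithTop ℕ∞))) ∧ (∀ (M :
Type) [TopologicalSpace M] [T2Space M] [SecondCountableTopology M] [ChartedSpace (EuclideanSpace ℝ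
(Fin 4)) M] [IsManifold (𝓡 4) ((⊤ : ℕ∞) : WithTop ℕ∞) M], (M ≃ₕ (Metric.sphere (0 : EuclideanSpace ℝ
(Fin 5)) 1)) → ∃ (g : ℕ) (k : Fin 3 → ℕ) (T : Fin 3 → Set M),
Literature.Topology.FourManifolds.IsGKTrisection M g k T ∧ ∃ i, g ≤ k i + 2)`

## Assembly
Pure logic over three PROVED tree theorems (compactness and an orientation of a homotopy 4-sphere;
χ: g = k₀+k₁+k₂ for every
GK-trisection of it): take the trisection (g;k) with g ≤ kᵢ + 2 given by DefectAtMostTwo; if some g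
≤ kⱼ + 1 the floor
LargeKStandard applies; otherwise g = kᵢ + 2 and every kⱼ + 2 ≤ g, so by χ the other two kⱼ sum to
2: some kⱼ = 0 →
TwoRLinkStandard, no kⱼ = 0 → the other two kⱼ are 1: relabel (PROVED `IsGKTrisection.comp_perm`) so
the (g−2)-sector is the middle slot, apply TrisectionHandles to get a Morse function with one
index-1 and one index-3 point, then GtriMorse1121. The deciding theorem is
glue.lean `closes (hK) (hH) (hR) (hG) (hC) : _root_.SmoothPoincare4` (kernel-checked, axioms propext
/ Classical.choice / Quot.sound);
the node file also proves the graded schema `closes_defect D` (floor + grades 2…D + ceiling D ⟹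
root, any D) of which `closes`
is D = 2 (`closes_via_schema`). The Assembly item is the schema-required restatement (not
load-bearing; `closes` is).

Rationale: WHY THIS LINE. Mechanism: the Gay–Kirby / Meier–Schirmer–Zupan dictionary between
(g;k₀,k₁,k₂)-trisections and handle decompositions
(one 0-handle, k₀ 1-handles, g − k₁ 2-handles, k₂ 3-handles; arXiv:1507.06561 §4, arXiv:1205.1565
Lemma 13; tree named fact
`Literature.Topology.FourManifolds.gkTrisection_exists_isMorse_isSelfIndexing` =
WeakReductionDescent item 19737) makes the
NUMBER OF 2-HANDLES a trisection invariant g − max kᵢ that is typable over the vetted predicate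
`IsGKTrisection`, computable
(an upper bound) from ANY handle presentation, and whose value ≤ 1 is exactly the proved range
(Gabai Property R; MSZ Thm 1.2).
Imported from 3-manifold topology / Heegaard theory: generalized Property R (arXiv:1103.1601), thin
position for
generalized square knots (arXiv:1904.08527), Gluck twists of roll-spun knots via torus surgery
(arXiv:2009.05703). What the line
does that the tree does not: NoOneHandles (#0377, all n, no 1-handles) and GroupTrisection (#0435, ≤
one 1- /3-handle) are cut
DOWN to two 2-handles and placed as the two types of ONE grade, with kernel bridges
(`twoRLinkStandard_of_noohGscStandard`,
`morse11211Standard_of_gtriMorse1121` under the printed dictionary), and the existence ceiling «two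
2-handles suffice» is typed
and S-implied; versus the gen-0 genus ladder (TrisectionGenusLadder / RootDecompE): unconditionally
GenusAtMostFour →
DefectAtMostTwo and DefectStandard 2 → StronglyIrreducibleThreeStandard ∧ GenusFourDescends
(kernel), i.e. a weaker residual
bought by stronger, better-instrumented grade pieces. Negatives index: empty (ledger negatives
SmoothPoincare4: 0 rows). Workshop record (writer decomp-sp4-writer-1 g2, cell decomp-sp4, rung 0,
D-0178): this is root node TwoHandleLadder of lens 1, generation 2, in its DEDUP VARIANT (a2)
registration (NODE 2026-08-30T02:39:43Z on HOME/STATUS.md line 73; lens kernel file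
decomp-sp4-lens-1/gen2/TwoHandleLadder.lean sha256
de0f0c1e8cebb716b13ff4767dbc8a160a31488f67612c234ac669b45e34a1bc — `closes` + four NECESSITY
theorems `…_of_spc4` + exact iff `smoothPoincare4_iff_twoHandleLadder` + graded schema
`closes_defect D` (any ceiling D; `closes` is D = 2 via `closes_via_schema`) with the in-kernel
COSTUME record `defectAtMost_one_iff_spc4` (bottom) / `defectAtMost_two_iff_spc4` /
`defectAtMost_succ_iff_of_grade` + the comparison to the genus ladder RootDecompE
(`defectAtMostTwo_of_genusAtMostFour`, `stronglyIrreducibleThreeStandard_of_defectStandard_two`,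
`genusFourDescends_of_defectStandard_two`) + the bridges `twoRLinkStandard_of_noohGscStandard`
(#0377 ∧ #19737 ⟹ T₀₂), `morse11211Standard_of_gtriMorse1121` (#0435 ∧ #19737 ⟹ T₁₁); dedup package
decomp-sp4-lens-1/gen2/variant-a2/ (Route.md sha256
ab28848e15852ee6fe4834912ab274cb6353276443f3e0f6d1b08d987401dade, route.json sha256
ff8af43a81ada550cc18efb5f00279b0d1d76eaf628154e328b59accee358396, glue.lean sha256
91ceea5ecf116fb0b739c3289a367474569602b6ebd73b3bcf198f509c576cd6, glue nonce b15878f504b8def8,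
SketchA2.lean rc0 / 0 sorry / axioms std); writer re-check of the rendered route: schema rc 0,
native glue verdict OK, tribunal kernel pre-check recorded in the writer NOTES), adopted as
OR-sibling RootDecompG of the root decomposition (critic scoring: RE-GRADING / OR-sibling of
RootDecompE; shares items stmt-SmoothPoincare4-25314 (E floor), stmt-SmoothPoincare4-19737
(WeakReductionDescent dictionary) and stmt-SmoothPoincare4-0435 (GroupTrisection) by verbatim
signature; new content = TwoRLinkStandard + the ceiling DefectAtMostTwo). Critic verdict: CLEARED
decomp-sp4-crit-1 g2 2026-08-30T02:45:59Z (HOME/STATUS.md line 77 «CLEARED … NODE lens-1 g2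
TwoHandleLadder (S ⟺ LargeKStandard[K] ∧ TwoRLinkStandard[T₀₂] ∧ Morse11211Standard[T₁₁] ∧
DefectAtMostTwo[C₂]; file decomp-sp4-lens-1/gen2/TwoHandleLadder.lean sha256 de0f0c1e…; MY lean
check rc0 · 0 sorry · 0 warnings · #print axioms closes = [propext, Classical.choice, Quot.sound];
variant-a2/SketchA2.lean rc0 · axioms(closes) std; dedup bodies VERBATIM …)»; CRITIC-LEDGER.md row
2026-08-30T02:45:59Z): verdict SPLIT-WITH-RESIDUAL expected (residual = [DefectAtMostTwo]; attacked
= TwoRLinkStandard; BC5 rung in print arXiv:1904.08527 Thm 1.1, plan-only T3); per-piece critic tags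
— K LargeKStandard: support · FLOOR (MSZ16 Thm 1.2) · provable-now · dedup #25314; T₀₂
TwoRLinkStandard: crux r2 · WEAKER-as-statement (⟸ #0377 ∧ #19737 kernel; = weak generalized
Property R at n = 2, manifold-level, NOT slide-triviality ⇒ outside A16) · ATTACKABLE (MZ
thin-position engine) · INSTRUMENTABLE (M2|n=2) · node score; T₁₁ GtriMorse1121: crux r3 · IMPORTED
≡ #0435 mod dictionary · WEAKER-as-statement · UNDECIDED specimens 𝒟_m,n(K), m odd, n ≠ 0, u(K) ≥ 2
· INSTRUMENTABLE (kirby-cert on the smallest such 𝒟_1,1(K), K ∈ {7₃,7₄,7₅} per the lens W2 answer) ·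
IDEA-NEEDED beyond u = 1; C₂ DefectAtMostTwo: crux r4 · EXISTENCE half · DECLARED-RESIDUAL · WEAKER
(evidence off S⁴: h₂ ≤ 2 BY CONSTRUCTION on R-link spheres, 𝒟_m,n(K), Nash spheres) · UNDECIDED
(T-DEFECT) · ⟸ gen-0 residual C₄ #25313 unconditionally. Critic correction W1 (prose only, no kernel
change, applied by the lens 2026-08-30T02:46:43Z and carried here): presentation-sphere doubles
∂N⁵(P) = D(H_P) carry handles (1,n,2n,n,1), so Φ4 specimens of AC-nontrivial balanced 2-generator P
have only h₂ ≤ 4 by construction and are UNDECIDED for the ceiling, not inside it. Tribunal flag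
from the critic (t1a, informational): items #17999 and #25312 of RootDecompE are DOMINATED by {#0435
∧ #19737 ∧ K} resp. DefectStandard 2 via the lens kernel lemmas. Census files cited:
HOME/census/COSTUME-CENSUS-v1.md sha256
2113a3b3fb46bf7e878c545d4df5cf6f6d17f195411b0a604bea94d1c5e2365a (json
4ecf75d8f1243bec80a6cd253a099e5495e481c469a741cd69a87d0230d84e02) and COSTUME-CENSUS-v2.md (POSTED
2026-08-30T02:55:50Z, HOME/STATUS.md line 89) sha256
02211b46d43d699232fc560c718b1cf4ae1c41a87299f7c87264174dde2b97f7 (json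
df090f965f8cc31bc294150024f4a2914dafa28cb95c4de6d8dcabeeb3737b1b; superseded pre-post draft md
54939177…) — specimen families Φ1 CS / Φ2 Gluck / Φ3 R-links / Φ4 presentation spheres, instrument
menu M2/M3 (R-links), the lens-proposed bookkeeping test T-DEFECT for the next census generation;
census gen-2 INSTRUMENT RESULT M2′ (line 89, evidence HOME/census/M2PRIME-n2-le16.md, kit j337648):
no 2-component R-link with ≤ 16 crossings has both components knotted, so TwoRLinkStandard has NO
specimen among 2-component R-link spheres below 17 crossings (its undecided population starts at ≥
17 crossings or at pairs with an unknotted component beyond the MZ22 generalized-square-knot class).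
Why this is novel (one sentence): no route in the tree and no paper found types the split of SPC4 by
2-HANDLE NUMBER into the two handle-types of grade 2 plus the S-implied ceiling «two 2-handles
suffice» — the nearest, NoOneHandles (#0377/#0378) and GroupTrisection (#0435), are single-mechanism
statements without a typed ceiling, and the sibling RootDecompE grades by genus with a strictly
stronger residual (C₄ ⟹ C₂ in kernel).

RANKED CRUXES. #2 TwoRLinkStandard (crux) — grade 2, type {g−2,2,0} — «two-2-handle spheres without
1-handles are standard»: a smooth homotopy 4-sphere carrying a GK-trisection (g;k) of defect exactly
2 (every kᵢ + 2 ≤ g, equality for some i) with some kⱼ = 0 is diffeomorphic to S⁴. By χ the type is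
{g−2,2,0}; read (0, g−2, 2) it is a handle decomposition with no 1-handles, two 2-handles, two
3-handles, i.e. Σ = X_L for a 2-component R-link L (arXiv:1507.06561 Prop 4.2/Lemma 4.6).
arXiv:1904.08527 Thm 1.1 is the sub-case «one component a generalized square knot»; item
stmt-SmoothPoincare4-0377 (all n) implies it given the dictionary (kernel
`twoRLinkStandard_of_noohGscStandard`). Manifold-level (Σ ≅ S⁴), NOT slide-triviality of L. [critic
decomp-sp4-crit-1 g2, CLEARED 2026-08-30T02:45:59Z (HOME/STATUS.md line 77): crux r2 · ATTACKED
conjunct · WEAKER-as-statement (⟸ #0377 ∧ #19737 in kernel) · ATTACKABLE · INSTRUMENTABLE (M2|n=2);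
BC5 rung in print arXiv:1904.08527 Thm 1.1 (plan-only T3)] [difficulty: open-problem] (why it might
fail: an exotic X_L for a 2-component R-link with no generalized-square-knot component (census
Φ3/M2: 2R-links ≥ 15 crossings unresolved); past arXiv:1904.08527 Thm 1.1 no recogniser exists and
Weak Property 2R (Hopf pairs allowed) may genuinely fail.) [arXiv:1904.08527, arXiv:1103.1601,
arXiv:1507.06561, arXiv:1102.3207]
#3 GtriMorse1121 (crux) — grade 2, type {g−2,1,1} filed AS the EXISTING item
stmt-SmoothPoincare4-0435 (route GroupTrisection), VERBATIM (dedup by signature intended): a compact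
smooth homotopy 4-sphere carrying a Morse function with exactly one minimum, one maximum, at most
one critical point of index 1 and at most one of index 3 (hence, by χ, at most two of index 2:
profiles 1-1-2-1-1 and its degenerations) is diffeomorphic to S⁴. With the dictionary
TrisectionHandles it gives the trisection type {g−2,1,1} (node file
`morse11211Standard_of_gtriMorse1121`); `closes` inlines that bridge. Population: Gompf's twisted
doubles 𝒟_m,n(K) of Mazur-type corks (arXiv:1603.05090 §2(c),(d), Question 2.2). [critic
decomp-sp4-crit-1 g2, CLEARED 2026-08-30T02:45:59Z (HOME/STATUS.md line 77): crux r3 · IMPORTED ≡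
#0435 mod dictionary #19737 (count once under GroupTrisection) · WEAKER-as-statement · UNDECIDED
(𝒟_m,n(K), m odd, n ≠ 0, u(K) ≥ 2) · INSTRUMENTABLE · IDEA-NEEDED beyond u = 1] [difficulty:
open-problem] (why it might fail: an exotic Gompf twisted double 𝒟_m,n(K), m odd, n ≠ 0, K 2-bridge
with unknotting number ≥ 2 (= Gluck twist of the n-roll spin of K): arXiv:2009.05703 Cor 3.6 stops
at unknotting number one; the 1-handle need not cancel against either 2-handle.) [arXiv:1603.05090,
arXiv:2009.05703, arXiv:1609.04345, arXiv:2503.04607]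
#4 DefectAtMostTwo (crux) — the ceiling (DECLARED RESIDUAL) — «two 2-handles suffice»: every smooth
homotopy 4-sphere carries a GK-trisection (g;k) with g ≤ kᵢ + 2 for some i, i.e. (arXiv:1507.06561
Prop 4.2 / Lemma 4.6) a handle decomposition with one 0-handle, at most two 2-handles and one
4-handle. S-implied (S⁴ has genus 0); ≡ S only modulo the floor AND both grade-2 pieces
(`defectAtMost_two_iff_spc4`); implied by the gen-0 residual unconditionally
(`defectAtMostTwo_of_genusAtMostFour`); holds BY CONSTRUCTION (not via Σ ≅ S⁴) on every 1- or
2-component R-link sphere, every 𝒟_m,n(K), every Nash sphere. [critic decomp-sp4-crit-1 g2, CLEARED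
2026-08-30T02:45:59Z (HOME/STATUS.md line 77): crux r4 · EXISTENCE half · DECLARED-RESIDUAL · WEAKER
(evidence off S⁴ by construction) · UNDECIDED (T-DEFECT; W1: Φ4 doubles (1,n,2n,n,1) undecided) · ⟸
RootDecompE residual #25313 in kernel] [difficulty: open-problem] (why it might fail: an exotic Σ
all of whose handle decompositions need ≥ 3 two-handles — e.g. X_L of a 3-component R-link that
never reduces, a Cappell–Shaneson Σ_A outside Gompf's standard sub-family, a cork twist of S⁴ with a
non-Mazur cork; no upper bound on h₂ of a homotopy sphere is known.) [arXiv:1507.06561,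
arXiv:1205.1565, arXiv:1103.1601, arXiv:1603.05090]
#9 LargeKStandard (support) — FLOOR (Meier–Schirmer–Zupan 2016 Thm 1.2, homotopy-sphere corollary =
defect ≤ 1 = «one 2-handle», Property-R territory; the tree's named fact
`Literature.Barriers.SmoothPoincare4.msz_homotopySphere_gk` over the Statement's bare binders) —
VERBATIM the gen-0 item TrisectionGenusLadder.LargeKStandard / RootDecompE floor (dedup by signature
intended): a GK-trisected smooth homotopy 4-sphere with some kᵢ ≥ g − 1 is diffeomorphic to S⁴.
[critic decomp-sp4-crit-1 g2 (line 77): support · FLOOR (MSZ16 Thm 1.2) · provable-now · dedup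
#25314] [difficulty: provable-now] [arXiv:1507.06561, arXiv:1410.8133]
#9 TrisectionHandles (support) — the trisection → handle DICTIONARY (theorem in print: Gay–Kirby
2016 Lemma 13, Meier–Schirmer–Zupan 2016 §4 Lemma 4.6, Milnor Thm 4.8): a (g;k₀,k₁,k₂)-trisected
closed connected oriented smooth 4-manifold has a self-indexing Morse function with one minimum, k₀
critical points of index 1, g − k₁ of index 2, k₂ of index 3, one maximum — VERBATIM route
WeakReductionDescent's item stmt-SmoothPoincare4-19737 (dedup by signature intended; reviewed
faithful 2026-08-17) = the tree's named fact
`Literature.Topology.FourManifolds.gkTrisection_exists_isMorse_isSelfIndexing`. [critic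
decomp-sp4-crit-1 g2 (line 77): support · DICTIONARY in print (GK16 Lemma 13 / MSZ16 Lemma 4.6) ·
provable-now · dedup #19737 (also byte-equal to WRD.GKHandleReading); enters only the bridges inside
`closes`] [difficulty: provable-now] [arXiv:1205.1565, arXiv:1507.06561]

TWO-LAYER PLAN. TwoRLinkStandard ⇐ (fibred / homotopy-ribbon component case, arXiv:1904.08527 Thm
1.5–1.7 programme) → (general case) if a
prover proposes the split; Morse11211Standard ⇐ (twisted doubles of Mazur corks = Gluck twists of
roll-spun 2-bridge knots,
arXiv:2009.05703) → (general one-1-handle case). Raising the ceiling is a tenure edit,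
kernel-prepared: add DefectStandard 3
(node file `closes_defect 3`; its types {3,0},{2,1} = 3-component R-link spheres / profile 1-1-3-2-1
…) and replace the
residual by DefectAtMost 3. Dedup variant for the writer: Morse11211Standard may be replaced by the
verbatim item 0435 plus the
support 19737 (dictionary), `closes` then routes through `morse11211Standard_of_gtriMorse1121`.

KILL CRITERIA. Refutation of any crux is an exotic 4-sphere (each is S-implied: `…_of_spc4` in the
node file) — closes the summit negatively,
not just the route. Mooted (superseded) if Weak generalized Property R for 2-component links
(arXiv:1103.1601 Conj 4 at n = 2)
and item 0435 are proved together with an h₂ ≤ 2 bound elsewhere. Pivot: if the census instrument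
(T-DEFECT below) finds the
hard specimens (CS Σ_A, 3-component R-link spheres, non-Mazur cork twists) stuck at h₂ ≥ 3, raise
the ceiling to 3 rather than
defend h₂ ≤ 2 (schema `closes_defect 3`).

NOT DECOMPOSED YET. The knot-theoretic content of grade 2 (which 2R-links beyond generalized square
knots; which roll-spun Gluck twists beyond
unknotting number one); h₂ upper bounds for the named families (Gluck twists Σ_K: h₂ ≤ b + 1 from a
banded-unlink diagram with b
bands; CS spheres via Akbulut–Kirby presentations; presentation spheres ∂N⁵(P) = D(H_P): handles
(1,n,2n,n,1), so only h₂ ≤ 2·#relators = 4 for balanced 2-generator P — undecided for the ceiling) —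
layer-2 supports for provers
and the census, not items. The converse dictionary (handles → trisection, arXiv:1507.06561 Prop 4.2)
is used only in prose.

CHEAPEST FALSIFIER. Lookup, run: BC7 crux probe 4/4 CLEAN (P5 C → S failed for all four; S → C fires
for the three recognition pieces,
informational; LargeKStandard P3 battery timed out — it is the printed floor); `ledger negatives
--problem SmoothPoincare4` = 0
rows; in print the nearest theorems (arXiv:1904.08527 Thm 1.1, arXiv:2009.05703 Cor 3.6,
arXiv:1102.3207 Thm 1) decide
SUB-families of the two grade-2 types and stop exactly where the cruxes start. Mathematical
near-miss: the likely
Property-2R counterexamples (GST L_n, Tange's η ∪ ε) are links whose spheres ARE S⁴ — they hit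
slide-level statements, not
these manifold-level ones. Instrument (census menu, not run here — kit not allowed): M2 restricted
to n = 2 (2R-links of 15–16
crossings, ≈ 70 core-h) bears on TwoRLinkStandard; Kirby-calculus certificates on 𝒟_m,n(K) for the
smallest 2-bridge K with
u(K) = 2 and m odd bear on Morse11211Standard; T-DEFECT (count 2-handles in the best known
presentations of Φ1 CS / Φ2 Gluck /
Φ4 presentation spheres, bookkeeping only) places every census specimen on the ladder and tests the
ceiling.

NUMBERS. Dictionary: (g;k₀,k₁,k₂) ↦ (1, k₀, g−k₁, k₂, 1) handles (arXiv:1507.06561 Lemma 4.6) and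
(g;n,c,m)-Heegaard–Kirby diagram ↦
(g;n,g−c,m)-trisection (Prop 4.2), so h₂(Σ) = min (g − max kᵢ); χ(Σ) = 2 ⇒ g = Σkᵢ; h₂ ≤ 1 ⇒
standard (Thm 1.2); grade-2 types
{g−2,2,0}, {g−2,1,1}; decided inside grade 2: Q_p,q-component 2R-links (arXiv:1904.08527 Thm 1.1),
Nash spheres (arXiv:1102.3207
Thm 1), 𝒟_m,n(K) for m even (Tange) or u(K) = 1 (arXiv:2009.05703 Cor 3.6), all R-links ≤ 14
crossings (census Φ3).

DEFINITION REQUESTS. None: `IsGKTrisection`, `IsMorse`, `IsSelfIndexing`, `criticalSetOfIndex`,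
`SmoothOrientation` exist (Literature.Topology.FourManifolds).

Novelty: Searches (2026-08-30): lit search --hybrid "homotopy 4-sphere handle decomposition two 2-handles no
1-handles standard" (8 held:
Gompf 1991 Killing the AK sphere, Kirby 1989, FQ90, …); lit search "Property 2R" --source local (1
relevant: arXiv:1102.3207);
lit search "Gompf infinite order corks" (held arXiv:1603.05090, 2009.05703, 1609.04345, 1904.09541);
lit galaxy search
"Property 2R|two 2-handles|2-handles suffice" --star all (12 rows, none stating the ceiling or the
grade split); tree: rg
"Property 2R|2R-link|two 2-handles" (Literature.Barriers.SmoothPoincare4.PropertyTwoRAndrewsCurtis,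
LADDER A4/A16, routes
NoOneHandles #0377/#0378, GroupTrisection #0435/#0436, VerlindeRLinks, WeakReductionDescent #19737),
gen-0 TrisectionGenusLadder
and the five sibling lens nodes (RootDecompA–D, KnotCertificate).
Nearest prior art found: arXiv:1904.08527 Thm 1.1 (the Q_p,q sub-case of TwoRLinkStandard) and
arXiv:1103.1601 Prop 9.2 (Weak
GPR ⟺ SPC4 for spheres without 1-handles); in the tree NoOneHandles (#0377 all n) and
GroupTrisection (#0435); gen-0 genus ladder.
Delta: the summit is cut by the 2-HANDLE NUMBER (a trisection-typable, presentation-computable grade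
whose value ≤ 1 is exactly
the proved range) into the two handle-types of grade 2 — each an existing programme's statement cut
down to two 2-handles, with
kernel bridges to items 0377/0435 — plus the typed S-implied ceiling «two 2-handles suffice», with
the graded schema, necessity,
COSTUME bottom and the comparison to the gen  [refs: 1102.3207, 1603.05090, 1904.08527, 1103.1601]

Barriers (technique_class: two-handle-ladder, trisection-defect, kirby-diagrams): - technique_class: two-handle-ladder, trisection-defect, kirby-diagrams
- BARRIERS.lean §A16 (PropertyTwoRAndrewsCurtis.lean, decls `StrictPropertyTwoRBarrier` /
`PropertyTwoRBarrier`; outside the gate catalogue, cited as prose): (A16, PropertyTwoRAndrewsCurtis)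
Andrews–Curtis obstructs SLIDE-ONLY Property 2R (GST §7, conditionally on AC-nontriviality);
TwoRLinkStandard concludes Σ ≅ S⁴ (= Weak Property 2R with Hopf pairs, which «destroys the
Andrews–Curtis invariant», GST §9 / Prop 9.2) and never asserts slide-triviality of L — outside the
barrier's technique class; the likely strict-2R counterexamples L_n (GST), η ∪ ε (Tange) have X_L =
S⁴ and satisfy the crux.
- Literature.Barriers.SmoothPoincare4.LowGenusTrisectionBarrier (LowGenusTrisectionsStandard.lean,
A10, with its companion decl `LargeKTrisectionBarrier`; MSZ16 Thm 1.2): (A10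
`LowGenusTrisectionBarrier` / `LargeKTrisectionBarrier`) records the PROVED part — a fake Σ has
defect ≥ 2 (no kᵢ ≥ g−1); the cruxes start exactly above it (defect = 2) and the floor enters as the
support LargeKStandard; its base, not a barrier to the line.
- BARRIERS.lean §A17 (WeaklyReducibleGenusThreeStandard.lean, decl
`az2025_weaklyReducible_genusThree_homotopySphere_gk`; not in the gate catalogue, cited as prose):
(A17) the genus-3 case (3;1,1,1) of Morse11211Standard is standard when weakly reducible; the crux
contains the strongly irreducible genus-3 locus and all g ≥ 4 — compatible, not excluded.
- BARRIERS.lean §B34 / §B35 (crux-level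

sub-problem: SmoothPoincare4 · status: draft · opened planner-decomp-sp4-writer-1-g2-0 2026-08-30T02:58:22Z · rev 1 · ledger route-SmoothPoincare4-RootDecompG
GENERATED by the gate from the ledger (D-0016/17). Provers cite these decls: `theorem foo : Summit.SmoothPoincare4.SmoothPoincare4.Theses.RootDecompG.<Decl> := …` in Summits/SmoothPoincare4/SmoothPoincare4/Theorems/<Name>.lean.
-/

namespace Summit.SmoothPoincare4.SmoothPoincare4.Theses.RootDecompG

open scoped BigOperators Topology Manifold Classical MeasureTheory ProbabilityTheory Matrix InnerProductSpace ComplexConjugate ContinuousMap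
open Filter Set Function TopologicalSpace MeasureTheory

attribute [summit_statement] _root_.SmoothPoincare4

open Literature.SPC4

/-- item stmt-SmoothPoincare4-26031 · crux · rank 2 · SPLIT (gen 1) into GenusOneTwoRLinkStandard, TwoRLinkStandardOffGenusOne, TwoZeroTrisectionIsRLinkSphere + glue TwoRLinkStandardGlue · direct attempts still welcome (low priority) · by planner
why it might fail: an exotic X_L for a 2-component R-link with no generalized-square-knot component (census Φ3/M2: 2R-links ≥ 15 crossings unresolved); past arXiv:1904.08527 Thm 1.1 no recogniser exists and Weak Property 2R (Hopf pairs allowed) may genuinely fail.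
sources: arXiv:1904.08527, arXiv:1103.1601, arXiv:1507.06561, arXiv:1102.3207
[crux] grade 2, type {g−2,2,0} — «two-2-handle spheres without 1-handles are standard»: a smooth
homotopy 4-sphere carrying a GK-trisection (g;k) of defect exactly 2 (every kᵢ + 2 ≤ g, equality for
some i) with some kⱼ = 0 is diffeomorphic to S⁴. By χ the type is {g−2,2,0}; read (0, g−2, 2) it is
a handle decomposition with no 1-handles, two 2-handles, two 3-handles, i.e. Σ = X_L for a
2-component R-link L (arXiv:1507.06561 Prop 4.2/Lemma 4.6). arXiv:1904.08527 Thm 1.1 is the sub-case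
«one component a generalized square knot»; item stmt-SmoothPoincare4-0377 (all n) implies it given
the dictionary (kernel `twoRLinkStandard_of_noohGscStandard`). Manifold-level (Σ ≅ S⁴), NOT
slide-triviality of L. [critic decomp-sp4-crit-1 g2, CLEARED 2026-08-30T02:45:59Z (HOME/STATUS.md
line 77): crux r2 · ATTACKED conjunct · WEAKER-as-statement (⟸ #0377 ∧ #19737 in kernel) ·
ATTACKABLE · INSTRUMENTABLE (M2|n=2); BC5 rung in print arXiv:1904.08527 Thm 1.1 (plan-only T3)]
[difficulty: open-problem] -/
@[route_item "route-SmoothPoincare4-RootDecompG", crux]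
def TwoRLinkStandard : Prop :=
  ∀ (M : Type) [TopologicalSpace M] [T2Space M] [SecondCountableTopology M] [ChartedSpace (EuclideanSpace ℝ (Fin 4)) M] [IsManifold (𝓡 4) ((⊤ : ℕ∞) : WithTop ℕ∞) M], (M ≃ₕ (Metric.sphere (0 : EuclideanSpace ℝ (Fin 5)) 1)) → ∀ (g : ℕ) (k : Fin 3 → ℕ) (T : Fin 3 → Set M), Literature.Topology.FourManifolds.IsGKTrisection M g k T → (∀ i, k i + 2 ≤ g) → (∃ i, g = k i + 2) → (∃ j, k j = 0) → Nonempty (Diffeomorph (𝓡 4) (𝓡 4) M (Metric.sphere (0 : EuclideanSpace ℝ (Fin 5)) 1) ((⊤ : ℕ∞) : WithTop ℕ∞))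

-- parent: TwoRLinkStandard · child (gen 1)
/--     item stmt-SmoothPoincare4-26834 · crux · rank 201 · open
    parent: TwoRLinkStandard · by planner
    why it might fail: A 2R-link Q ∪ J with genus(Q)=1, Q non-fibred, whose closed manifold X_L is exotic refutes it; no candidate is known (no both-knotted 2R-link with a genus-1 component is known at all; census v3 M2′a: none ≤ 17 crossings), and the statement is implied by SPC4.
    sources: arXiv:0901.2319, arXiv:1103.1601, arXiv:1904.08527, arXiv:1507.06561, doi:10.1007/bf01389054
[crux · M1 · ATTACKED · layer-2 rank 201] 2R-link spheres with a component of Seifert genus <= 1 are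
standard: a smooth homotopy 4-sphere that is the closed manifold X_L (IsRLinkSphere: trace of L plus
two 3-handles and a 4-handle) of a 2-component framed link L one of whose components bounds a
Seifert surface of genus <= 1 is diffeomorphic to S^4. Genus 0 = floor (GST/ST Prop 3.2 'the unknot
has Property 2R' + slides preserve X_L); genus-1 fibred (3_1, 4_1) vacuous (R-link components are
topologically slice); open content = non-fibred genus-one components (6_1, 9_46, genus-one slice
knots). By Scharlemann-Thompson Thm 3.3 (descent) this grade also carries every 2R-link sphere with
a FIBRED genus-2 component (4_1#4_1, 8_20, Kanenobu). WEAKER than TwoRLinkStandard (restriction;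
probes fail), S-implied; kernel cert decomp-sp4-lens-1/gen3/ComponentGenusLadder.lean. [critic
decomp-sp4-crit-1 g2, CLEARED 2026-08-30T03:35:17Z (HOME/STATUS.md line 123): M₁ NEW r201 · ATTACKED
· WEAKER (restriction; M₁⟹̸T₀₂, M₁⟹̸S probes FAIL by design; S⟹M₁ kernel) · UNDECIDED (T-G1;
population possibly empty in practice = K-G1) · ATTACKABLE-in-part (L-G1a reducible-filling,
K-G1-der metaboliser derivativ -/
@[route_item "route-SmoothPoincare4-RootDecompG"]
def GenusOneTwoRLinkStandard : Prop :=
  ∀ (M : Type) [TopologicalSpace M] [T2Space M] [SecondCountableTopology M] [ChartedSpace (EuclideanSpace ℝ (Fin 4)) M] [IsManifold (𝓡 4) ((⊤ : ℕ∞) : WithTop ℕ∞) M], (M ≃ₕ (Metric.sphere (0 : EuclideanSpace ℝ (Fin 5)) 1)) → ∀ L : Literature.Topology.FourManifolds.FramedLink (Fin 2), Literature.Topology.FourManifolds.IsRLinkSphere M L → (∃ (i : Fin 2) (g : ℕ), g ≤ 1 ∧ Literature.Topology.FourManifolds.Knot.HasSeifertSurfaceOfGenus (L.component i) g) → Nonempty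 (Diffeomorph (𝓡 4) (𝓡 4) M (Metric.sphere (0 : EuclideanSpace ℝ (Fin 5)) 1) ((⊤ : ℕ∞) : WithTop ℕ∞))

-- parent: TwoRLinkStandard · child (gen 1)
/--     item stmt-SmoothPoincare4-26835 · crux · rank 202 · open
    parent: TwoRLinkStandard · by planner
    why it might fail: An exotic X_L for a 2R-link with both components of genus ≥ 2; the classical candidates L_n = Q_{3,2} ∪ V_n were of this type and are standard (GST 2010, Meier–Zupan 2022), no live candidate remains, and the statement is implied by SPC4.
    sources: arXiv:1904.08527, arXiv:1103.1601, arXiv:1208.1299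
[crux · N1 · residual of the split (under TwoRLinkStandard), layer-2 rank 202] 2R-link spheres whose
presenting 2-component link has NO component with a Seifert surface of genus <= 1 (both components
of genus >= 2) are standard. Literal negation of GenusOneTwoRLinkStandard's hypothesis, so the glue
is by_cases; contains the decided families Q_{3,2} ∪ V_n (GST 2010) and Q_{p,q} ∪ J (Meier-Zupan
2022 Thm 1.1); ≡ TwoRLinkStandard modulo GenusOneTwoRLinkStandard ∧ TwoZeroTrisectionIsRLinkSphere
(+ reverse dictionary), S-implied; its next rungs (GenusGrade 2, GenusRest 2) are in the kernel
cert. [critic decomp-sp4-crit-1 g2, CLEARED 2026-08-30T03:35:17Z (HOME/STATUS.md line 123): N₁ NEW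
r202 · DECLARED-RESIDUAL (of the split; route residual DefectAtMostTwo #26032 unchanged) · WEAKER
(restriction) · UNDECIDED; T₀₂ ⟺ M₁ ∧ N₁ over (W₂, reverse dictionary) exact in kernel; contains the
decided Q_{3,2}∪V_n / Q_{p,q}∪J families; first undecided specimens ≥ 18 crossings (census v3 M2′a)]
Cert: decomp-sp4-lens-1/gen3/ComponentGenusLadder.lean sha256 85e2090c… + split/SigCheck.lean
71495baa… (NODE 03:33:01Z line 121). -/
@[route_item "route-SmoothPoincare4-RootDecompG"]
def TwoRLinkStandardOffGenusOne : Prop :=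
  ∀ (M : Type) [TopologicalSpace M] [T2Space M] [SecondCountableTopology M] [ChartedSpace (EuclideanSpace ℝ (Fin 4)) M] [IsManifold (𝓡 4) ((⊤ : ℕ∞) : WithTop ℕ∞) M], (M ≃ₕ (Metric.sphere (0 : EuclideanSpace ℝ (Fin 5)) 1)) → ∀ L : Literature.Topology.FourManifolds.FramedLink (Fin 2), Literature.Topology.FourManifolds.IsRLinkSphere M L → (¬ ∃ (i : Fin 2) (g : ℕ), g ≤ 1 ∧ Literature.Topology.FourManifolds.Knot.HasSeifertSurfaceOfGenus (L.component i) g) → Nonempty (Diffeomorph (𝓡 4) (𝓡 4) M (Metric.sphere (0 : EuclideanSpace ℝ (Fin 5)) 1) ((⊤ : ℕ∞) : WithTop ℕ∞))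

-- parent: TwoRLinkStandard · child (gen 1)
/--     item stmt-SmoothPoincare4-26836 · support · rank 203 · open
    parent: TwoRLinkStandard · by planner
    sources: arXiv:1507.06561, arXiv:1103.1601, Kirby1989
[support · W2 · COSTUME: theorem in print] The trisection → handle dictionary at type {g-2,2,0}: a
smooth homotopy 4-sphere with a GK-trisection (g;k) with all k_i+2 <= g, some g = k_i+2 and some k_j
= 0 is X_L for some 2-component framed link (IsRLinkSphere M L). = TrisectionHandles (#19737,
Meier-Schirmer-Zupan 2016 §4 induced handle decomposition 1,k1,g-k2,k3,1) at (0,g-2,2) after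
relabelling and g = Σk_i (χ = 2), then Kirby 1989 I.§2 / GST 2010 §9 (no 1-handles ⇒ trace of the
attaching 2-component link ∪ ♮²S¹×B³). The n-pinned sharpening of #25269 MorseGscIsRLinkSphere.
[critic decomp-sp4-crit-1 g2, CLEARED 2026-08-30T03:35:17Z (HOME/STATUS.md line 123): W₂ NEW support
· COSTUME (theorem in print: MSZ16 §4 = TrisectionHandles #19737 at (0,g−2,2) + Kirby 1989 I.§2 /
GST 2010 §9; the n-pinned sharpening of #25269 MorseGscIsRLinkSphere); prover road:
IsGKTrisection.comp_perm + gkTrisection_genus_eq_sum_of_homotopyEquiv_sphere_holds ⟹ self-indexing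
Morse function (1,0,2,2,1) ⟹ no 1-handles ⟹ IsRLinkSphere with n = 2] Cert:
decomp-sp4-lens-1/gen3/ComponentGenusLadder.lean sha256 85e2090c… + split/SigCheck.lean 71495baa…
(NODE 03:33:01Z line 121). -/
@[route_item "route-SmoothPoincare4-RootDecompG"]
def TwoZeroTrisectionIsRLinkSphere : Prop :=
  ∀ (M : Type) [TopologicalSpace M] [T2Space M] [SecondCountableTopology M] [ChartedSpace (EuclideanSpace ℝ (Fin 4)) M] [IsManifold (𝓡 4) ((⊤ : ℕ∞) : WithTop ℕ∞) M], (M ≃ₕ (Metric.sphere (0 : EuclideanSpace ℝ (Fin 5)) 1)) → ∀ (g : ℕ) (k : Fin 3 → ℕ) (T : Fin 3 → Set M), Literature.Topology.FourManifolds.IsGKTrisection M g k T → (∀ i, k i + 2 ≤ g) → (∃ i, g = k i + 2) → (∃ j, k j = 0) → ∃ L : Literature.Topology.FourManifolds.FramedLink (Fin 2), Literature.Topology.FourManifolds.IsRLinkSphere M L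

-- parent: TwoRLinkStandard · glue (gen 1)
/--     item stmt-SmoothPoincare4-26837 · support · rank 204 · open
    parent: TwoRLinkStandard · GLUE: children ⟹ parent · by planner
GenusOneTwoRLinkStandard → TwoRLinkStandardOffGenusOne → TwoZeroTrisectionIsRLinkSphere →
TwoRLinkStandard (pure logic: W₂ gives the 2-component R-link presentation, by_cases on a genus-≤1
component; kernel-closed by decomp-sp4-lens-1/gen3/split/SigCheck.lean `twoRLinkStandardGlue_holds`,
6 lines — prover landing Theorems/RootDecompGTwoRLinkStandardGlue.lean --workitem <this glue item>) -/
@[route_item "route-SmoothPoincare4-RootDecompG"]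
def TwoRLinkStandardGlue : Prop :=
  GenusOneTwoRLinkStandard → TwoRLinkStandardOffGenusOne → TwoZeroTrisectionIsRLinkSphere → TwoRLinkStandard

/-- item stmt-SmoothPoincare4-0435 · crux · rank 3 · open · by planner
why it might fail: an exotic Gompf twisted double 𝒟_m,n(K), m odd, n ≠ 0, K 2-bridge with unknotting number ≥ 2 (= Gluck twist of the n-roll spin of K): arXiv:2009.05703 Cor 3.6 stops at unknotting number one; the 1-handle need not cancel against either 2-handle.
sources: arXiv:1603.05090, arXiv:2009.05703, arXiv:1609.04345, arXiv:2503.04607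
Handle shadow of crux #2 and its formal strengthening: if Σ carries a Morse function with one
minimum, one maximum, at most one critical point of index 1 and at most one of index 3 (then
#index-2 = c₁ + c₃ ≤ 2 by χ = 2), then Σ ≅ S⁴. Cases (c₁,c₃) = (0,0): no middle handles;
(1,0)/(0,1): the 2-handle is attached to S¹×S² = ∂(S¹×B³) with an S³ surgery, so by Property R
[Gabai1987 Cor 8.3] it is isotopic to S¹×pt and cancels the 1-handle; (1,1): two 2-handles attached
to S¹×S² returning S¹×S² — the open content (a 2-component relative of Property R / GPRC in S¹×S²).
Complements route NoOneHandles item stmt-SmoothPoincare4-0377 (c₁ = 0, c₃ arbitrary). Sources: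
Gabai1987; MeierSchirmerZupan2016 §2 (trisection ↔ handle counts); Milnor1965 §3 (Morse ↔ handles);
GompfScharlemannThompson2010 (GPRC context). opens: `open scoped Manifold ContDiff`, `open
ContinuousMap`; imports: Summits.SmoothPoincare4.Statement +
Literature.Topology.FourManifolds.{HomotopySpheres,Morse,BalancedPresentation} +
Literature.Geometry.Kaehler.ManifoldForms. Elaborated 2026-08-13 with plain `lean check` (no
overlay). -/
@[route_item "route-SmoothPoincare4-RootDecompG", crux]
def GtriMorse1121 : Prop :=
  ∀ (M : Type) [TopologicalSpace M] [T2Space M] [SecondCountableTopology M] [ChartedSpace (EuclideanSpace ℝ (Fin 4)) M] [IsManifold (𝓡 4) ((⊤ : ℕ∞) : WithTop ℕ∞) M] [CompactSpace M], M ≃ₕ Metric.sphere (0 : EuclideanSpace ℝ (Fin 5)) 1 → ∀ f : M → ℝ, Literature.Topology.FourManifolds.IsMorse (𝓡 4) f → (Literature.Topology.FourManifolds.criticalSetOfIndex (𝓡 4) f 0).ncard = 1 → (Literature.Topology.FourManifolds.criticalSetOfIndex (𝓡 4) f 1).ncard ≤ 1 → (Literature.Topology.FourManifolds.criticalSetOfIndex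 (𝓡 4) f 3).ncard ≤ 1 → (Literature.Topology.FourManifolds.criticalSetOfIndex (𝓡 4) f 4).ncard = 1 → Nonempty (Diffeomorph (𝓡 4) (𝓡 4) M (Metric.sphere (0 : EuclideanSpace ℝ (Fin 5)) 1) ((⊤ : ℕ∞) : WithTop ℕ∞))

/-- item stmt-SmoothPoincare4-26032 · crux · rank 4 · open · by planner
why it might fail: an exotic Σ all of whose handle decompositions need ≥ 3 two-handles — e.g. X_L of a 3-component R-link that never reduces, a Cappell–Shaneson Σ_A outside Gompf's standard sub-family, a cork twist of S⁴ with a non-Mazur cork; no upper bound on h₂ of a homotopy sphere is known.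
sources: arXiv:1507.06561, arXiv:1205.1565, arXiv:1103.1601, arXiv:1603.05090
[crux] the ceiling (DECLARED RESIDUAL) — «two 2-handles suffice»: every smooth homotopy 4-sphere
carries a GK-trisection (g;k) with g ≤ kᵢ + 2 for some i, i.e. (arXiv:1507.06561 Prop 4.2 / Lemma
4.6) a handle decomposition with one 0-handle, at most two 2-handles and one 4-handle. S-implied (S⁴
has genus 0); ≡ S only modulo the floor AND both grade-2 pieces (`defectAtMost_two_iff_spc4`);
implied by the gen-0 residual unconditionally (`defectAtMostTwo_of_genusAtMostFour`); holds BY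
CONSTRUCTION (not via Σ ≅ S⁴) on every 1- or 2-component R-link sphere, every 𝒟_m,n(K), every Nash
sphere. [critic decomp-sp4-crit-1 g2, CLEARED 2026-08-30T02:45:59Z (HOME/STATUS.md line 77): crux r4
· EXISTENCE half · DECLARED-RESIDUAL · WEAKER (evidence off S⁴ by construction) · UNDECIDED
(T-DEFECT; W1: Φ4 doubles (1,n,2n,n,1) undecided) · ⟸ RootDecompE residual #25313 in kernel]
[difficulty: open-problem] -/
@[route_item "route-SmoothPoincare4-RootDecompG", crux]
def DefectAtMostTwo : Prop :=
  ∀ (M : Type) [TopologicalSpace M] [T2Space M] [SecondCountableTopology M] [ChartedSpace (EuclideanSpace ℝ (Fin 4)) M] [IsManifold (𝓡 4) ((⊤ : ℕ∞) : WithTop ℕ∞) M], (M ≃ₕ (Metric.sphere (0 : EuclideanSpace ℝ (Fin 5)) 1)) → ∃ (g : ℕ) (k : Fin 3 → ℕ) (T : Fin 3 → Set M), Literature.Topology.FourManifolds.IsGKTrisection M g k T ∧ ∃ i, g ≤ k i + 2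

/-- item stmt-SmoothPoincare4-19737 · support · rank 9 · open · by planner
sources: arXiv:1205.1565, arXiv:1507.06561
[crux] Gay–Kirby 2016 Lemma 13 over the tree's IsGKTrisection — DEFINITIONALLY the Literature named
fact Literature.Topology.FourManifolds.gkTrisection_exists_isMorse_isSelfIndexing (a proof of this
item discharges the fact by `rfl` transport): a closed connected oriented smooth 4-manifold with a
(g; k 0, k 1, k 2) GK-trisection carries a self-indexing Morse function with critical-point counts
(1, k 0, g − k 1, k 2, 1) by index (MSZ16 §4 Def 4.1 / Lemma 4.6 bookkeeping; χ = 2 + g − Σ k i).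
PROMOTED TO CRUX by route-choice rchoice-…-4c94971c (2026-08-17): it was the XL apex of the landed
conditional proof of LowGenusBase (Theorems/WeakReductionDescentLowGenusBaseLeaves, p161251) and is
the trisection↔handle dictionary of the X₁ line
(Theorems/WeakReductionDescentDependentTripleAtThreeOfGtriMorse1121); with the supports
PropertyRClosing + LaudenbachPoenaru it yields LowGenusBase through the provable-now glue
LowGenusBaseOfLeaves, so the g ≤ 2 rung becomes an interior node of `closes`. Natural split
(fact-file review): (a) X 0 ≅ ♮^{k 0} S¹×B³ as the 0∪1-handles (HasHandleDecomposition clause of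
IsGKTrisection, in tree); (b) middle sector: the genus-g Heegaard splitting of ∂X 0 ≅ #^{k -/
@[route_item "route-SmoothPoincare4-RootDecompG", crux]
def TrisectionHandles : Prop :=
  ∀ (X : Type) [TopologicalSpace X] [T2Space X] [SecondCountableTopology X] [ChartedSpace (EuclideanSpace ℝ (Fin 4)) X] [IsManifold (𝓡 4) ((⊤ : ℕ∞) : WithTop ℕ∞) X] [CompactSpace X] [ConnectedSpace X] (_ : Literature.Topology.FourManifolds.SmoothOrientation (𝓡 4) X) (g : ℕ) (k : Fin 3 → ℕ) (S : Fin 3 → Set X), Literature.Topology.FourManifolds.IsGKTrisection X g k S → ∃ f : X → ℝ, Literature.Topology.FourManifolds.IsMorse (𝓡 4) f ∧ Literature.Topology.FourManifolds.IsSelfIndexing (𝓡 4) f ∧ (Literature.Topology.FourManifolds.criticalSetOfIndex (𝓡 4) f 0).ncard = 1 ∧ (Literature.Topology.FourManifolds.criticalSetOfIndex (𝓡 4) f 1).ncard = k 0 ∧ (Literature.Topology.FourManifolds.criticalSetOfIndex (𝓡 4) f 2).ncard = g - k 1 ∧ (Literature.Topology.FourManifolds.criticalSetOfIndex (𝓡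 4) f 3).ncard = k 2 ∧ (Literature.Topology.FourManifolds.criticalSetOfIndex (𝓡 4) f 4).ncard = 1

/-- item stmt-SmoothPoincare4-25314 · support · rank 9 · open · by planner
sources: arXiv:1507.06561, arXiv:1410.8133
[support] FLOOR (Meier–Schirmer–Zupan 2016 Thm 1.2, homotopy-sphere corollary; the tree's named fact
`Literature.Barriers.SmoothPoincare4.msz_homotopySphere_gk` over the Statement's bare binders —
provable-now from it with the compact/orientation plumbing of
Theorems/WeakReductionDescentTrisectionsExist): a GK-trisected smooth homotopy 4-sphere with some kᵢ
≥ g − 1 is diffeomorphic to S⁴. [difficulty: provable-now] -/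
@[route_item "route-SmoothPoincare4-RootDecompG", crux]
def LargeKStandard : Prop :=
  ∀ (M : Type) [TopologicalSpace M] [T2Space M] [SecondCountableTopology M] [ChartedSpace (EuclideanSpace ℝ (Fin 4)) M] [IsManifold (𝓡 4) ((⊤ : ℕ∞) : WithTop ℕ∞) M], (M ≃ₕ (Metric.sphere (0 : EuclideanSpace ℝ (Fin 5)) 1)) → ∀ (g : ℕ) (k : Fin 3 → ℕ) (T : Fin 3 → Set M), Literature.Topology.FourManifolds.IsGKTrisection M g k T → (∃ i, g ≤ k i + 1) → Nonempty (Diffeomorph (𝓡 4) (𝓡 4) M (Metric.sphere (0 : EuclideanSpace ℝ (Fin 5)) 1) ((⊤ : ℕ∞) : WithTop ℕ∞))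

/-- item stmt-SmoothPoincare4-26033 · assembly · rank 1 · open · by planner
sources: arXiv:1507.06561, arXiv:1904.08527
[assembly] LargeKStandard → TrisectionHandles → TwoRLinkStandard → GtriMorse1121 → DefectAtMostTwo →
SmoothPoincare4 (schema restatement of the deciding theorem `closes`; not load-bearing) -/
@[route_item "route-SmoothPoincare4-RootDecompG"]
def Assembly : Prop :=
  LargeKStandard → TrisectionHandles → TwoRLinkStandard → GtriMorse1121 → DefectAtMostTwo → _root_.SmoothPoincare4

/-! D-0027 §2.1 — DECIDING THEOREM (planner-authored via `route open/edit --closes-file`; by planner-decomp-sp4-writer-1-g2-0 2026-08-30T02:58:22Z):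
its hypotheses are this route's items and its conclusion the sub-problem Statement (glue_lint), and it elaborates with this file. -/

@[closes "route-SmoothPoincare4-RootDecompG"] theorem closes (hK : LargeKStandard) (hH : TrisectionHandles) (hR : TwoRLinkStandard)
    (hG : GtriMorse1121) (hC : DefectAtMostTwo) : _root_.SmoothPoincare4 := by
  unfold SmoothPoincare4 Literature.SPC4.SmoothPoincareConjectureFour
    ContinuousMap.HomotopyEquiv.NonemptyDiffeomorphSphere
  intro M _ _ _ _ _ e
  haveI : CompactSpace M :=
    Literature.Topology.FourManifolds.compactSpace_of_homotopyEquiv_sphere_four_holds M e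
  haveI : PathConnectedSpace M := by
    haveI := Literature.Topology.FourManifolds.pathConnectedSpace_sphere_four
    exact Literature.Topology.FourManifolds.pathConnectedSpace_of_homotopyEquiv e
  obtain ⟨o⟩ :=
    Literature.Topology.FourManifolds.isOrientable_of_homotopyEquiv_sphere_four_holds M e
  obtain ⟨g, k, T, hT, i, hi⟩ := hC M e
  have hs : g = k 0 + k 1 + k 2 :=
    Literature.Topology.FourManifolds.gkTrisection_genus_eq_sum_of_homotopyEquiv_sphere_holds
      M o g k T hT e
  by_cases hfl : ∃ j, g ≤ k j + 1
  · exact hK M e g k T hT hfl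
  · push Not at hfl
    have f0 := hfl 0
    have f1 := hfl 1
    have f2 := hfl 2
    have hle : ∀ j, k j + 2 ≤ g := fun j => by have := hfl j; omega
    have hgi : g = k i + 2 := by have := hfl i; omega
    by_cases h0 : ∃ j, k j = 0
    · exact hR M e g k T hT hle ⟨i, hgi⟩ h0
    · push Not at h0
      have a0 := h0 0
      have a1 := h0 1
      have a2 := h0 2
      have hki : k i = k 0 ∨ k i = k 1 ∨ k i = k 2 := by
        fin_cases i
        exacts [Or.inl rfl, Or.inr (Or.inl rfl), Or.inr (Or.inr rfl)]
      -- type {g-2,1,1}: relabel so that the (g-2)-sector is the middle (2-handle) slot, then the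
      -- trisection → handle dictionary gives a Morse function of profile 1-1-2-1-1 and item 0435 applies
      rcases hki with c | c | c
      · have hT' :=
          Literature.Topology.FourManifolds.IsGKTrisection.comp_perm hT (Equiv.swap 0 1)
        obtain ⟨f, hf, -, n0, n1, -, n3, n4⟩ :=
          hH M o g (k ∘ Equiv.swap 0 1) (T ∘ Equiv.swap 0 1) hT'
        rw [Function.comp_apply, (by decide : Equiv.swap (0 : Fin 3) 1 0 = 1)] at n1
        rw [Function.comp_apply, (by decide : Equiv.swap (0 : Fin 3) 1 2 = 2)] at n3
        exact hG M e f hf n0 (by rw [n1]; omega) (by rw [n3]; omega) n4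
      · have hT' := Literature.Topology.FourManifolds.IsGKTrisection.comp_perm hT 1
        obtain ⟨f, hf, -, n0, n1, -, n3, n4⟩ :=
          hH M o g (k ∘ (1 : Equiv.Perm (Fin 3))) (T ∘ (1 : Equiv.Perm (Fin 3))) hT'
        rw [Function.comp_apply, Equiv.Perm.one_apply] at n1 n3
        exact hG M e f hf n0 (by rw [n1]; omega) (by rw [n3]; omega) n4
      · have hT' :=
          Literature.Topology.FourManifolds.IsGKTrisection.comp_perm hT (Equiv.swap 1 2)
        obtain ⟨f, hf, -, n0, n1, -, n3, n4⟩ :=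
          hH M o g (k ∘ Equiv.swap 1 2) (T ∘ Equiv.swap 1 2) hT'
        rw [Function.comp_apply, (by decide : Equiv.swap (1 : Fin 3) 2 0 = 0)] at n1
        rw [Function.comp_apply, (by decide : Equiv.swap (1 : Fin 3) 2 2 = 1)] at n3
        exact hG M e f hf n0 (by rw [n1]; omega) (by rw [n3]; omega) n4

end Summit.SmoothPoincare4.SmoothPoincare4.Theses.RootDecompG
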